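import Mathlib
import Summits.HodgeConjecture.FermatCycles.HodgeFermatDecodingRingB

/-!
# LEMMA E for every GOOD character at EVERY level — part 1: good characters, the μ- and ν-parts (`HodgeFermat/LemmaEGood.lean`; HF-G32c)

Tree copy (part 1 of 2) of the module `HodgeFermat/LemmaEGood.lean` of the sibling cell's standalone package
`run/shared/lean/pub/pub-hodgefermat/lean/HodgeFermat/` (645 lines, sha256 `d2bae049509fdda0…`), source lines 47–329 (§1 good characters: `L(χ,0) ≠ 0`, `S_N(χ) ≠ 0`; §2 LEMMA E μ-part; §3 LEMMA E ν-part — every level, good characters).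
Filed by cell `pub-hfermat`, seat prover-1 gen-2, on the COORDINATOR KEEPER RULING of 2026-08-25 (gem sweep H1: take the
off-gate kernel theorem `thmFstar` through the gate) — here its second namesake, `HodgeFermat/ThmFstarNFinal.lean:29`,
THEOREM F*(3N) at every admissible squarefree level (the first, `DecodingFinal.thmFstar` = THEOREM F* at the prime levels,
landed on 2026-08-25 as `HodgeFermatThmFstar.lean`, seat prover-1 gen-0); this file is one link of the import closure of
`ThmFstarNFinal.thmFstar` on top of that landed chain.  The source module's declarations are VERBATIM those of the cell record
`check/ThmFstarN_standalone.lean` (21 bodies, 438 871 B, sha256 ced731ec52c92191…, hub `lean check` rc 0, 222.2 s, `--axioms …ThmFstarN.thmFstarN` = [propext, Classical.choice, Quot.sound]; pub-hodgefermat `CERT.md` l.987, GATE HF-G33).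
Deviations from the source module, exhaustively: the `import` lines (tree modules `Summits.HodgeConjecture.FermatCycles.
HodgeFermat*` instead of `HodgeFermat.*`); this module docstring; one-line docstrings added (gate lint) to `primitiveCharacter_odd`, `isUnit_three`, `hat_muFun`; the file ends at source l.329 (`end nu`) with an `end` line (part 2 = `HodgeFermatLemmaEGoodB.lean`).
Every other line — in particular every declaration's statement and proof — is byte-identical to the source.
HONEST FRAMING: explicit algebraic cycles for specific Hodge classes on Fermat/Delsarte varieties; residual open instances
listed; no claim on general Hodge.  (This file is arithmetic of CM types / of `(ℤ/N)ˣ`; it claims nothing about cycles.)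

The source module's docstring (LemmaEGood.lean l.3–45), verbatim:

## LEMMA E for every GOOD character at EVERY level, and THEOREM F\*(3N) from the vanishing of the Bad coefficients (HF-G32c)

`tables/DPRIME-THEOREM.md` §6 (LEMMA E with its Bad set) and §7 at an ARBITRARY level `m₁ = N` (`3 ∤ N`), in the
kernel up to the one remaining analytic input — the Bad set.

A Dirichlet character `χ` mod `N` is GOOD (`Good χ`) when its primitive character `χ₀` (conductor `f ∣ N`) takes
the value `1` at NO prime `q ∣ N` (for `q ∣ f` this is automatic: `χ₀(q) = 0`).  By
`L(χ, 0) = L(χ₀, 0) · ∏_{q ∣ N} (1 − χ₀(q))` (Mathlib's `DirichletCharacter.LFunction_changeLevel`) and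
`L(χ₀, 0) ≠ 0` for odd primitive `χ₀` (`LemmaEMu.lfunction_zero_ne_zero`), an odd character has `L(χ, 0) ≠ 0` —
equivalently a non-vanishing twisted first moment `S_N(χ) = −N·L(χ, 0)` (from H0) — EXACTLY when it is good
(§1).  Hence (§2, §3) LEMMA E, μ-part and ν-part with `m₀ = 3`, holds at every level `N` (`1 < N`, `3 ∤ N`) for
every GOOD odd `ψ` mod `N` resp. every even `ψ` mod `N` with `χ₃ × ψ` good — the gen-31 theorems
`LemmaEMu.lemmaE_mu` / `NuChar.lemmaE_nu3` being the case `N = p` prime, where every character in question is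
good (§4: `good_of_prime`, `good_chi3Mul_of_prime`).  Finally (§5) the Fourier inversions of `MuEven` / `NuOdd` /
`NuOddSharp` — which never used primality — give PARITY(3N) of `DecodingRing` for two zero-sum triples with
entries prime to `N` and the same CM type at level `3N`, PROVIDED the coefficients at the BAD characters vanish as
well (`BadVanishMu`, `BadVanishNu`: the content of DPRIME §7.2–7.4, NOT proved here) and `φ(N) ≥ 10`,
`φ(N) ≠ 12` (the integrality step — automatic for odd `N ≥ 11`, `3 ∤ N`, `N ≠ 13`: `totient_conditions`; even `N` is
vacuous); with the ring decoding `DecodingRing.thmF_of_parity` this is THEOREM F\*(3N) for pairs with entries prime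
to `N`, at every `N ≥ 11`, `3 ∤ N`, `N ≠ 13`, CONDITIONAL on the Bad coefficients only (`thmFstar_of_bad`); at a prime level the Bad conditions are vacuous and `thmFstar_prime` is `Decoding.thmFstar`
once more.

Main statements (all from `h0 : H0` where analytic):
* `Good`, `good_of_dvd_conductor`, `good_of_isPrimitive`, `primitiveCharacter_apply_of_modEq` (`χ₀(q) = χ(q′)` for a lift
  `q′ ≡ q (mod f)` prime to `N`), `good_of_apply_ne_one`, `not_good_of_apply_eq_one` (Bad ⟺ `χ(q′) = 1` at a lift of
  some prime `q ∣ N`, `q ∤ f`); `lfunction_zero_ne_zero_of_good (χ : DirichletCharacter ℂ N) (hχ : χ.Odd) (hgood : Good χ) :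
  χ.LFunction 0 ≠ 0`, `moment_ne_zero_of_good`;
* `lemmaE_mu_of_good (h0) (h1N : 1 < N) (h3N : ¬ 3 ∣ N) (ψ : DirichletCharacter ℂ N) (hψ : ψ.Odd) (hgood : Good ψ) …
  (hT : SameType (3 * N) (a, b, c) (a', b', c')) : ehat ψ a + ehat ψ b + ehat ψ c = ehat ψ a' + ehat ψ b' + ehat ψ c'`
  and its transform form `hat_mu_diff_eq_zero_of_good`;
* `lemmaE_nu_of_good` (odd good `χ` mod `3N` ramified at 3), `lemmaE_nu3_of_good (ψ : DirichletCharacter ℂ N)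
  (hψ : ψ.Even) (hgood : Good (chi3Mul ψ)) … : nu3 ψ a + nu3 ψ b + nu3 ψ c = nu3 ψ a' + nu3 ψ b' + nu3 ψ c'` and
  `hat_nu_diff_eq_zero_of_good`;
* `mu_even_of_bad`, `nu_key_of_bad`, `nu_sum_eq_of_bad`, `nu_odd_of_bad`, `parity_of_bad` (these with `10 ≤ φ(N)`, `φ(N) ≠ 12`),
  `thmFstar_of_bad_totient`, `totient_conditions` (the totient conditions hold for every odd `N ≥ 11`, `3 ∤ N`,
  `N ≠ 13`), and `thmFstar_of_bad (h0) (hn11 : 11 ≤ N) (h3N : ¬ 3 ∣ N) (hn13 : N ≠ 13) … (hD) (hT)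
  (hμ : BadVanishMu N (a, b, c) (a', b', c')) (hν : BadVanishNu N (a, b, c) (a', b', c')) : False`;
* `thmFstar_prime` (prime `p ≥ 11`, `p ≠ 13`: unconditional given H0).

LIGHT module (imports `DecodingRing`); no `sorry`; no `decide`; axioms [propext, Classical.choice, Quot.sound]
(hub record `check/LemmaEGood_standalone.lean`, 12 bodies).  NOT imported by the root `HodgeFermat.lean`.
-/

namespace HodgeFermat.KRFree.LemmaEGood

open Finset HodgeFermat.KRFree.LemmaN HodgeFermat.KRFree.TwistedMoment HodgeFermat.KRFree.LemmaEMu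
open HodgeFermat.KRFree.ChiThree (chi3 chi3_of_dvd units)
open HodgeFermat.KRFree.LemmaENu (nhat nuw_toFun moment_eq_LFunction isPrimitive_three_mul)
open HodgeFermat.KRFree.NuChar (chi3Mul chi3Mul_natCast chi3Mul_inv chi3Mul_ram chi3Mul_ne_one nu3 nhat_chi3Mul)
open HodgeFermat.KRFree.MuEven (muEntry muFun even_of_hat_odd_eq_zero)
open HodgeFermat.KRFree.NuOdd (nuEntry nuFun nuEntry_eq_zero hat_nuFun sum_nuEntry_one totient_mul_add_neg)
open HodgeFermat.KRFree.NuOddSharp (chi3_sum_cases int_aux)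
open HodgeFermat.KRFree.DecodingRing (Parity thmF_of_parity)

/-! ## 1. Good characters: `L(χ, 0) ≠ 0` and `S_N(χ) ≠ 0` for odd good `χ` at any level -/

section good

variable {N : ℕ}

/-- `χ` mod `N` is GOOD (not in the Bad set of LEMMA E): its primitive character is `≠ 1` at every prime of `N`. -/
def Good (χ : DirichletCharacter ℂ N) : Prop :=
  ∀ q ∈ N.primeFactors, χ.primitiveCharacter (q : ZMod χ.conductor) ≠ 1

/-- a character every prime of whose level divides its conductor is good (the value there is `0`) -/
lemma good_of_dvd_conductor (χ : DirichletCharacter ℂ N) (h : ∀ q ∈ N.primeFactors, q ∣ χ.conductor) :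
    Good χ := by
  intro q hq h1
  have hq' := Nat.prime_of_mem_primeFactors hq
  have hnu : ¬ IsUnit ((q : ℕ) : ZMod χ.conductor) := by
    intro hu
    have hcop := (ZMod.isUnit_iff_coprime q χ.conductor).mp hu
    exact hq'.one_lt.ne' (Nat.Coprime.eq_one_of_dvd hcop (h q hq))
  exact one_ne_zero (h1.symm.trans (MulChar.map_nonunit _ hnu))

/-- in particular a PRIMITIVE character is good -/
lemma good_of_isPrimitive (χ : DirichletCharacter ℂ N) (hprim : χ.IsPrimitive) : Good χ :=
  good_of_dvd_conductor χ (fun q hq => by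
    rw [(DirichletCharacter.isPrimitive_def χ).mp hprim]
    exact Nat.dvd_of_mem_primeFactors hq)

/-- the primitive character of an odd character is odd -/
lemma primitiveCharacter_odd (χ : DirichletCharacter ℂ N) (hχ : χ.Odd) : χ.primitiveCharacter.Odd := by
  show χ.primitiveCharacter (-1) = -1
  have h := DirichletCharacter.primitiveCharacter_apply_of_isCoprime χ (a := -1)
    (isCoprime_one_left.neg_left)
  push_cast at h
  rw [h]
  exact hχ

/-- the primitive character at a residue `q` prime to the conductor `f` is the character at any lift `q′ ≡ q (mod f)`
prime to `N` — this makes `Good` checkable: `χ` is BAD iff `χ(q′) = 1` for some prime `q ∣ N`, `q ∤ f`, and such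
a lift `q′` of `q` (DPRIME §6: `χ_f(q) = 1`). -/
theorem primitiveCharacter_apply_of_modEq (χ : DirichletCharacter ℂ N) {q q' : ℕ} (hq' : Nat.Coprime q' N)
    (h : q' ≡ q [MOD χ.conductor]) :
    χ.primitiveCharacter (q : ZMod χ.conductor) = χ (q' : ZMod N) := by
  conv_rhs => rw [← DirichletCharacter.changeLevel_primitiveCharacter χ]
  rw [← ZMod.coe_unitOfCoprime q' hq',
    DirichletCharacter.changeLevel_eq_cast_of_dvd χ.primitiveCharacter χ.conductor_dvd_level,
    ZMod.coe_unitOfCoprime, ZMod.cast_natCast χ.conductor_dvd_level]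
  congr 1
  exact ((ZMod.natCast_eq_natCast_iff' q' q _).mpr h).symm

/-- `χ` is good as soon as, for every prime `q ∣ N` not dividing the conductor, SOME lift `q′` of `q` has `χ(q′) ≠ 1` -/
theorem good_of_apply_ne_one (χ : DirichletCharacter ℂ N)
    (h : ∀ q ∈ N.primeFactors, ¬ q ∣ χ.conductor →
      ∃ q' : ℕ, Nat.Coprime q' N ∧ q' ≡ q [MOD χ.conductor] ∧ χ (q' : ZMod N) ≠ 1) : Good χ := by
  intro q hq
  by_cases hqf : q ∣ χ.conductor
  · have hq' := Nat.prime_of_mem_primeFactors hq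
    have hnu : ¬ IsUnit ((q : ℕ) : ZMod χ.conductor) := by
      intro hu
      have hcop := (ZMod.isUnit_iff_coprime q χ.conductor).mp hu
      exact hq'.one_lt.ne' (Nat.Coprime.eq_one_of_dvd hcop hqf)
    intro h1
    exact one_ne_zero (h1.symm.trans (MulChar.map_nonunit _ hnu))
  · obtain ⟨q', hq'N, hmod, hne⟩ := h q hq hqf
    rw [primitiveCharacter_apply_of_modEq χ hq'N hmod]
    exact hne

/-- conversely `χ(q′) = 1` at a lift of a prime `q ∣ N` makes `χ` BAD -/
theorem not_good_of_apply_eq_one (χ : DirichletCharacter ℂ N) {q q' : ℕ} (hq : q ∈ N.primeFactors)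
    (hq' : Nat.Coprime q' N) (hmod : q' ≡ q [MOD χ.conductor]) (h1 : χ (q' : ZMod N) = 1) : ¬ Good χ := by
  intro hg
  apply hg q hq
  rw [primitiveCharacter_apply_of_modEq χ hq' hmod, h1]

variable [NeZero N]

/-- `L(χ, 0) ≠ 0` for an odd GOOD character at any level: `L(χ, 0) = L(χ₀, 0)·∏_{q ∣ N} (1 − χ₀(q))`. -/
theorem lfunction_zero_ne_zero_of_good (χ : DirichletCharacter ℂ N) (hχ : χ.Odd) (hgood : Good χ) :
    χ.LFunction 0 ≠ 0 := by
  haveI : NeZero χ.conductor := ⟨DirichletCharacter.conductor_ne_zero χ⟩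
  have h := DirichletCharacter.LFunction_changeLevel χ.conductor_dvd_level χ.primitiveCharacter
    (s := 0) (Or.inr zero_ne_one)
  rw [DirichletCharacter.changeLevel_primitiveCharacter] at h
  rw [h]
  refine mul_ne_zero (lfunction_zero_ne_zero _ (DirichletCharacter.primitiveCharacter_isPrimitive χ)
    (primitiveCharacter_odd χ hχ)) ?_
  rw [Finset.prod_ne_zero_iff]
  intro q hq
  rw [neg_zero, Complex.cpow_zero, mul_one]
  exact sub_ne_zero.mpr (hgood q hq).symm

/-- `S_N(χ) ≠ 0` for an odd GOOD character at any level (from H0). -/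
theorem moment_ne_zero_of_good (h0 : H0) (χ : DirichletCharacter ℂ N) (hχ : χ.Odd) (hgood : Good χ) :
    moment N (toFun χ) ≠ 0 := by
  rw [moment_eq_LFunction h0 χ hχ]
  exact mul_ne_zero (neg_ne_zero.mpr (Nat.cast_ne_zero.mpr (NeZero.ne N)))
    (lfunction_zero_ne_zero_of_good χ hχ hgood)

omit [NeZero N] in
/-- `3` is a unit of `ZMod N` when `3 ∤ N` -/
lemma isUnit_three (h3N : ¬ 3 ∣ N) : IsUnit (3 : ZMod N) := by
  have h : Nat.Coprime 3 N := (Nat.Prime.coprime_iff_not_dvd Nat.prime_three).mpr h3N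
  have hu := (ZMod.unitOfCoprime 3 h).isUnit
  rw [ZMod.coe_unitOfCoprime, Nat.cast_ofNat] at hu
  exact hu

end good

/-! ## 2. LEMMA E, μ-part, `m₀ = 3`, every level, good odd `ψ` -/

section mu

variable {N : ℕ}

/-- **LEMMA E (μ-part, m₀ = 3, ANY level; from H0).**  `1 < N`, `3 ∤ N`, `ψ` an odd GOOD character mod `N`,
`T`, `T′` zero-sum triples mod `3N` with entries prime to `N` and the same CM type at level `3N`:
`Σ_{x ∈ T} ê(x) = Σ_{x ∈ T′} ê(x)`. -/
theorem lemmaE_mu_of_good (h0 : H0) (h1N : 1 < N) (h3N : ¬ 3 ∣ N) (ψ : DirichletCharacter ℂ N) (hψ : ψ.Odd)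
    (hgood : Good ψ) {a b c a' b' c' : ℕ} (hs : 3 * N ∣ a + b + c) (hs' : 3 * N ∣ a' + b' + c')
    (ha : Nat.Coprime a N) (hb : Nat.Coprime b N) (hc : Nat.Coprime c N)
    (ha' : Nat.Coprime a' N) (hb' : Nat.Coprime b' N) (hc' : Nat.Coprime c' N)
    (hT : SameType (3 * N) (a, b, c) (a', b', c')) :
    ehat ψ a + ehat ψ b + ehat ψ c = ehat ψ a' + ehat ψ b' + ehat ψ c' := by
  haveI : NeZero N := ⟨by omega⟩
  have key := mu_identity (toFun_isChar ψ) h1N h3N (fun x hx => toFun_mul_inv ψ hx)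
    hs hs' ha hb hc ha' hb' hc' hT
  have hM : mass N (toFun ψ) = 0 :=
    mass_eq_zero_of_odd (toFun_isChar ψ) h1N (toFun_neg_one ψ hψ h1N) (fun z hz => by
      rcases mul_eq_zero.mp hz with h | h
      · norm_num at h
      · exact h)
  simp only [muw_eq (toFun_isChar ψ) h1N h3N (toFun_one ψ), hM, mul_zero, zero_mul, add_zero,
    mue_toFun] at key
  have h3S : (3 : ℂ) * moment N (toFun ψ) ≠ 0 :=
    mul_ne_zero (by norm_num) (moment_ne_zero_of_good h0 ψ hψ hgood)
  apply mul_left_cancel₀ h3S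
  linear_combination key

variable [NeZero N]

/-- `Σ_x μ_a(x)·ψ⁻¹(x) = ê_a(ψ)` for one entry, at any level with `3 ∤ N` -/
lemma hat_muEntry (h3N : ¬ 3 ∣ N) (ψ : DirichletCharacter ℂ N) (a : ℕ) :
    ∑ x : ZMod N, (muEntry a x : ℂ) * ψ⁻¹ x = ehat ψ a := by
  unfold muEntry ehat
  by_cases h3 : 3 ∣ a
  · simp only [h3, if_true]
    push_cast
    simp only [ite_mul, zero_mul, Finset.sum_ite_eq, Finset.mem_univ, if_true]
  · simp only [h3, if_false]
    push_cast
    simp only [sub_mul, ite_mul, one_mul, zero_mul, Finset.sum_sub_distrib, Finset.sum_ite_eq, Finset.mem_univ,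
      if_true]
    obtain ⟨t, ht⟩ := isUnit_three h3N
    have hsum : ∑ x : ZMod N, (if ((a : ℕ) : ZMod N) = 3 * x then ψ⁻¹ x else 0)
        = ψ (3 : ZMod N) * ψ⁻¹ ((a : ℕ) : ZMod N) := by
      have key : ∀ x : ZMod N,
          (((a : ℕ) : ZMod N) = 3 * x) ↔ (((t⁻¹ : (ZMod N)ˣ) : ZMod N) * ((a : ℕ) : ZMod N) = x) := by
        intro x
        constructor
        · intro h; rw [h, ← mul_assoc, ← ht, Units.inv_mul, one_mul]
        · intro h; rw [← h, ← mul_assoc, ← ht, Units.mul_inv, one_mul]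
      simp_rw [key]
      rw [Finset.sum_ite_eq, if_pos (Finset.mem_univ _), map_mul]
      congr 1
      rw [MulChar.inv_apply, Ring.inverse_unit, inv_inv, ht]
    rw [hsum]

/-- the `ψ⁻¹`-coefficient of `μ_T` is `ê(a) + ê(b) + ê(c)` -/
lemma hat_muFun (h3N : ¬ 3 ∣ N) (ψ : DirichletCharacter ℂ N) (a b c : ℕ) :
    ∑ x : ZMod N, (muFun (a, b, c) x : ℂ) * ψ⁻¹ x = ehat ψ a + ehat ψ b + ehat ψ c := by
  simp only [muFun, Int.cast_add, add_mul, Finset.sum_add_distrib, hat_muEntry h3N]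

/-- LEMMA E (μ) in transform form at any level: the coefficient of `μ_T − μ_T′` at an odd GOOD `ψ` vanishes. -/
theorem hat_mu_diff_eq_zero_of_good (h0 : H0) (h1N : 1 < N) (h3N : ¬ 3 ∣ N) (ψ : DirichletCharacter ℂ N)
    (hψ : ψ.Odd) (hgood : Good ψ) {a b c a' b' c' : ℕ} (hs : 3 * N ∣ a + b + c) (hs' : 3 * N ∣ a' + b' + c')
    (ha : Nat.Coprime a N) (hb : Nat.Coprime b N) (hc : Nat.Coprime c N)
    (ha' : Nat.Coprime a' N) (hb' : Nat.Coprime b' N) (hc' : Nat.Coprime c' N)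
    (hT : SameType (3 * N) (a, b, c) (a', b', c')) :
    ∑ x : ZMod N, ((muFun (a, b, c) x - muFun (a', b', c') x : ℤ) : ℂ) * ψ⁻¹ x = 0 := by
  have h := lemmaE_mu_of_good h0 h1N h3N ψ hψ hgood hs hs' ha hb hc ha' hb' hc' hT
  simp only [Int.cast_sub, sub_mul, Finset.sum_sub_distrib, hat_muFun h3N, h, sub_self]

end mu

/-! ## 3. LEMMA E, ν-part, `m₀ = 3`, every level, good characters ramified at 3 -/

section nu

variable {N : ℕ}

/-- **LEMMA E (ν-part, m₀ = 3, ANY level; from H0).**  `1 < N`, `3 ∤ N`, `χ` an odd GOOD character mod `3N`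
with `χ(j) ≠ 1` at the units `j ≡ 2 (3)`, `j ≡ 1 (N)` (ramified at 3); `T`, `T′` zero-sum triples mod `3N` with
entries prime to `N` and the same CM type: `Σ_{x ∈ T, 3 ∤ x} χ⁻¹(x) = Σ_{x ∈ T′, 3 ∤ x} χ⁻¹(x)`. -/
theorem lemmaE_nu_of_good (h0 : H0) (h1N : 1 < N) (h3N : ¬ 3 ∣ N) (χ : DirichletCharacter ℂ (3 * N))
    (hχ : χ.Odd)
    (hram : ∀ j : ℕ, Nat.Coprime j (3 * N) → j % 3 = 2 → j % N = 1 % N → χ (j : ZMod (3 * N)) ≠ 1)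
    (hgood : Good χ)
    {a b c a' b' c' : ℕ} (hs : 3 * N ∣ a + b + c) (hs' : 3 * N ∣ a' + b' + c')
    (ha : Nat.Coprime a N) (hb : Nat.Coprime b N) (hc : Nat.Coprime c N)
    (ha' : Nat.Coprime a' N) (hb' : Nat.Coprime b' N) (hc' : Nat.Coprime c' N)
    (hT : SameType (3 * N) (a, b, c) (a', b', c')) :
    nhat χ a + nhat χ b + nhat χ c = nhat χ a' + nhat χ b' + nhat χ c' := by
  haveI : NeZero (3 * N) := ⟨by omega⟩
  have hram' : ∀ j, Nat.Coprime j (3 * N) → j % 3 = 2 → j % N = 1 % N →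
      ∀ z : ℂ, toFun χ j * z = z → z = 0 := by
    intro j hj hj3 hjp z hz
    have hne : toFun χ j - 1 ≠ 0 := sub_ne_zero.mpr (hram j hj hj3 hjp)
    have h0' : (toFun χ j - 1) * z = 0 := by rw [sub_mul, one_mul, hz, sub_self]
    rcases mul_eq_zero.mp h0' with h | h
    · exact absurd h hne
    · exact h
  have lift : ∀ {x : ℕ}, Nat.Coprime x N → 3 ∣ x ∨ Nat.Coprime x (3 * N) := by
    intro x hx
    by_cases h3 : 3 ∣ x
    · exact Or.inl h3
    · exact Or.inr (coprime_three_mul_iff.mpr ⟨h3, hx⟩)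
  have nz : ∀ {x : ℕ}, Nat.Coprime x N → ¬ 3 * N ∣ x := by
    intro x hx h
    have hNx : N ∣ x := dvd_trans (dvd_mul_left N 3) h
    exact absurd ((Nat.coprime_comm.mp hx).eq_one_of_dvd hNx) h1N.ne'
  have key := nu_identity (toFun_isChar χ) (by omega) h3N (fun x hx => toFun_mul_inv χ hx) hram'
    hs hs' (lift ha) (lift hb) (lift hc) (lift ha') (lift hb') (lift hc') (nz hc) (nz hc') hT
  simp only [nuw_toFun] at key
  exact mul_left_cancel₀ (moment_ne_zero_of_good h0 χ hχ hgood) key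

/-- `ψ` even ⟹ `χ₃ × ψ` odd (any level `N ≥ 1`) -/
lemma chi3Mul_odd (h1N : 1 ≤ N) (ψ : DirichletCharacter ℂ N) (hψ : ψ.Even) : (chi3Mul ψ).Odd := by
  have h1 : 1 ≤ 3 * N := by omega
  have hcop : Nat.Coprime (3 * N - 1) (3 * N) := by
    have h : Nat.Coprime (3 * N - 1 + 1) (3 * N - 1) :=
      Nat.coprime_self_add_left.mpr (Nat.coprime_one_left _)
    rw [Nat.sub_add_cancel h1] at h
    exact Nat.coprime_comm.mp h
  show chi3Mul ψ (-1) = -1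
  have e : (-1 : ZMod (3 * N)) = ((3 * N - 1 : ℕ) : ZMod (3 * N)) := by
    rw [Nat.cast_sub h1, ZMod.natCast_self, Nat.cast_one, zero_sub]
  have e' : ((3 * N - 1 : ℕ) : ZMod N) = -1 := by
    rw [Nat.cast_sub h1, Nat.cast_mul, ZMod.natCast_self, mul_zero, Nat.cast_one, zero_sub]
  have e3 : chi3 (3 * N - 1) = -1 := by
    unfold chi3
    have : (3 * N - 1) % 3 = 2 := by omega
    simp [this]
  rw [e, chi3Mul_natCast ψ hcop, e', e3]
  rw [show ψ (-1) = 1 from hψ]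
  push_cast
  ring

/-- **LEMMA E (ν-part, m₀ = 3, ANY level, χ = χ₃ × ψ; from H0).**  `1 < N`, `3 ∤ N`, `ψ` an EVEN character
mod `N` with `χ₃ × ψ` GOOD mod `3N`; `T`, `T′` as before: `Σ_{x ∈ T, 3 ∤ x} χ₃(x)ψ⁻¹(x) = Σ_{x ∈ T′, 3 ∤ x} χ₃(x)ψ⁻¹(x)`. -/
theorem lemmaE_nu3_of_good (h0 : H0) (h1N : 1 < N) (h3N : ¬ 3 ∣ N) (ψ : DirichletCharacter ℂ N)
    (hψ : ψ.Even) (hgood : Good (chi3Mul ψ)) {a b c a' b' c' : ℕ} (hs : 3 * N ∣ a + b + c)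
    (hs' : 3 * N ∣ a' + b' + c')
    (ha : Nat.Coprime a N) (hb : Nat.Coprime b N) (hc : Nat.Coprime c N)
    (ha' : Nat.Coprime a' N) (hb' : Nat.Coprime b' N) (hc' : Nat.Coprime c' N)
    (hT : SameType (3 * N) (a, b, c) (a', b', c')) :
    nu3 ψ a + nu3 ψ b + nu3 ψ c = nu3 ψ a' + nu3 ψ b' + nu3 ψ c' := by
  have key := lemmaE_nu_of_good h0 h1N h3N (chi3Mul ψ) (chi3Mul_odd (by omega) ψ hψ)
    (fun j hj hj3 hjp => chi3Mul_ram ψ hj hj3 hjp) hgood hs hs' ha hb hc ha' hb' hc' hT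
  simpa only [nhat_chi3Mul ψ ha, nhat_chi3Mul ψ hb, nhat_chi3Mul ψ hc, nhat_chi3Mul ψ ha',
    nhat_chi3Mul ψ hb', nhat_chi3Mul ψ hc'] using key

variable [NeZero N]

/-- LEMMA E (ν) in transform form at any level: the coefficient of `ν_T − ν_T′` at an even `ψ` with `χ₃ × ψ`
good vanishes. -/
theorem hat_nu_diff_eq_zero_of_good (h0 : H0) (h1N : 1 < N) (h3N : ¬ 3 ∣ N) (ψ : DirichletCharacter ℂ N)
    (hψ : ψ.Even) (hgood : Good (chi3Mul ψ)) {a b c a' b' c' : ℕ} (hs : 3 * N ∣ a + b + c)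
    (hs' : 3 * N ∣ a' + b' + c')
    (ha : Nat.Coprime a N) (hb : Nat.Coprime b N) (hc : Nat.Coprime c N)
    (ha' : Nat.Coprime a' N) (hb' : Nat.Coprime b' N) (hc' : Nat.Coprime c' N)
    (hT : SameType (3 * N) (a, b, c) (a', b', c')) :
    ∑ x : ZMod N, ((nuFun (a, b, c) x - nuFun (a', b', c') x : ℤ) : ℂ) * ψ⁻¹ x = 0 := by
  have h := lemmaE_nu3_of_good h0 h1N h3N ψ hψ hgood hs hs' ha hb hc ha' hb' hc' hT
  simp only [Int.cast_sub, sub_mul, Finset.sum_sub_distrib, hat_nuFun, h, sub_self]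

end nu

end HodgeFermat.KRFree.LemmaEGood
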